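import Literature.Probability.RandomPlanarGeometry.LoewnerImageStepCircle
import Mathlib.Analysis.Complex.RemovableSingularity
import Mathlib.Analysis.Complex.AbsMax
import HarnessLib

/-!
# One step of the conformal image of a Loewner chain, III: the residue estimates

Sequel to `LoewnerImageStepCircle` (notation there). Integrating the circle identity

  `h'(ζ) - h(ζ) = a/E_B(ζ) - E_{B'}'(ζ - U_u)·2u/ζ + O(aη + uη + u²)`     (`|ζ| = ρ`)

over `|ζ| = ρ₀` kills the holomorphic left side (`∮ (h' - h) = 0`) and evaluates the two poles at
`0` (`∮ dζ/E_B(ζ) = 2πi/d`, `∮ E_{B'}'(ζ - U_u) dζ/ζ = 2πi E_{B'}'(-U_u)`), giving Lawler's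
capacity identity in quantitative form

  `|a/d - 2u E_{B'}'(-U_u)| ≤ 192 a η/(d²ρ₀) + 32 u η/ρ₀ + 128 u²/ρ₀²`,  hence `a ≤ 6 d u`

(`norm_stepCap_div_sub_le`, `stepCap_le`; Lawler (4.15): "`hcap(g_s(γ[s, s+u])) = 2u`" becomes
`a ≈ 2 d² u` after the conjugation by `h`, whose derivative at the tip is `d`). Feeding this back:
**`|h'(z) - h(z)| ≤ 30 u/ρ₀` on `|z| ≤ ρ₀`** (`norm_hmapT_sub_hmap_le`, maximum modulus) and
`|(h' - h)'(z)| ≤ 60 u/ρ₀²` on `|z| ≤ ρ₀/2` (Cauchy) — the Lipschitz-in-time property of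
`t ↦ h_t(z)` used for [LSW] Prop. 5.2 — and finally the **first-order expansion**

  `|h'(z) - h(z) - 2u · D(z)| ≤ C(ρ₀, d) · u (η + u)`,   `|z| ≤ ρ₀/4`,

with `D` the holomorphic function `D(z) = d²/E_B(z) - E_B'(z)/z` (given by its Cauchy integral
over `|ζ| = ρ₀/2`; `norm_hmapT_sub_hmap_sub_le`) — the time-derivative formula
`∂_t h_t(z) = 2 Φ_t'(W_t)²/(h_t(z) - h_t(W_t)) - 2 h_t'(z)/(z - W_t)` of Lawler's Prop. 4.40 /
[LSW] (5.2) in slid coordinates, with an explicit error.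

## References

* G. F. Lawler, *Conformally Invariant Processes in the Plane* (2005), §4.6.1, Prop. 4.40–4.41
  and (4.15) [Lawler2005].
* G. F. Lawler, O. Schramm, W. Werner, *Conformal restriction: the chordal case* (2003), §5
  (5.1)–(5.3) [LawlerSchrammWerner2003Restriction].
-/

noncomputable section

open Set Filter Metric Bornology Function
open _root_.Complex _root_.Topology _root_.Real
open UpperHalfPlane (upperHalfPlaneSet isOpen_upperHalfPlaneSet)
open Literature.Analysis.Complex (IsHydrodynamicAt hcapAt)
open scoped ComplexConjugate NNReal

namespace Literature.Probability.RandomPlanarGeometry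

namespace Loewner

variable {B : Set ℂ} {Φ : ConformalEquiv (upperHalfPlaneSet \ B) upperHalfPlaneSet} {d ρ₀ : ℝ}
  {U : ℝ≥0 → ℝ} {u : ℝ≥0} {S : ℝ}
  {Φ' : ConformalEquiv (upperHalfPlaneSet \ slidHull U B u) upperHalfPlaneSet}
variable (hB : IsStarHull B) (hΦ : IsRestrictionMap B Φ) (hd : HasRestrictionDeriv B Φ d)
  (hU : Continuous U) (hU0 : U 0 = 0) (hu : 0 < u) (hS : ∀ v : ℝ≥0, v ≤ u → |U v| ≤ S)
  (hρ₀ : 0 < ρ₀) (hBρ : Disjoint (ball (0 : ℂ) (8 * ρ₀)) B)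
  (hη : stepSize S u ≤ d * ρ₀ / 1000)
  (hΦ' : IsRestrictionMap (slidHull U B u) Φ')

/-! ### Holomorphy of `h`, `h'` and `h' - h` near `0` -/

include hB hΦ hρ₀ hBρ in
/-- `B(0, 4ρ₀) ⊆ symmDomain B`, and `E_B`, `h = hmap Φ` are differentiable there. [folklore] -/
theorem differentiableOn_hmap : ball (0 : ℂ) (4 * ρ₀) ⊆ symmDomain B ∧
    DifferentiableOn ℂ (hullExt Φ) (ball (0 : ℂ) (4 * ρ₀)) ∧
    DifferentiableOn ℂ (hmap Φ) (ball (0 : ℂ) (4 * ρ₀)) := by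
  have hsub : ball (0 : ℂ) (4 * ρ₀) ⊆ symmDomain B := by
    have := ball_subset_symmDomain (B := B) (x := 0) (r := 8 * ρ₀) (by simpa using hBρ)
    rw [ofReal_zero] at this
    exact (ball_subset_ball (by linarith)).trans this
  have hE := (differentiableOn_hullExt hB.isBoundedHull hΦ).mono hsub
  exact ⟨hsub, hE, hE.sub_const _⟩

include hB hΦ hd hU hU0 hu hS hρ₀ hBρ hη hΦ' in
/-- `h' = hmapT Φ' (U u)` is differentiable on `B(0, 5ρ₀)`. [folklore] -/
theorem differentiableOn_hmapT : DifferentiableOn ℂ (hmapT Φ' (U u)) (ball (0 : ℂ) (5 * ρ₀)) :=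
  fun _ hy ↦ (hasDerivAt_hmapT hB hΦ hd hU hU0 hu hS hρ₀ hBρ hη hΦ'
    (mem_ball_zero_iff.1 hy).le).differentiableAt.differentiableWithinAt

include hB hΦ hd hU hU0 hu hS hρ₀ hBρ hη hΦ' in
/-- `h' - h` is differentiable on `B(0, 4ρ₀)`, with derivative `E_{B'}'(z - U_u) - E_B'(z)`.
[folklore] -/
theorem hasDerivAt_hmapT_sub_hmap {z : ℂ} (hz : z ∈ ball (0 : ℂ) (4 * ρ₀)) :
    HasDerivAt (fun w ↦ hmapT Φ' (U u) w - hmap Φ w)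
      (deriv (hullExt Φ') (z - U u) - deriv (hullExt Φ) z) z := by
  obtain ⟨hsub, hE, -⟩ := differentiableOn_hmap hB hΦ hρ₀ hBρ
  have h1 := hasDerivAt_hmapT hB hΦ hd hU hU0 hu hS hρ₀ hBρ hη hΦ' (y := z)
    (by have := mem_ball_zero_iff.1 hz; linarith)
  have h2 : HasDerivAt (hmap Φ) (deriv (hullExt Φ) z) z :=
    ((hE.differentiableAt (isOpen_ball.mem_nhds hz)).hasDerivAt).sub_const _
  exact h1.sub h2

include hB hΦ hd hU hU0 hu hS hρ₀ hBρ hη hΦ' in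
/-- `h' - h` is differentiable on `B(0, 4ρ₀)`. [folklore] -/
theorem differentiableOn_hmapT_sub_hmap :
    DifferentiableOn ℂ (fun w ↦ hmapT Φ' (U u) w - hmap Φ w) (ball (0 : ℂ) (4 * ρ₀)) :=
  fun _ hz ↦ (hasDerivAt_hmapT_sub_hmap hB hΦ hd hU hU0 hu hS hρ₀ hBρ hη hΦ' hz).differentiableAt.differentiableWithinAt

/-! ### The three contour integrals over `|ζ| = ρ₀` -/

include hB hΦ hd hU hU0 hu hS hρ₀ hBρ hη hΦ' in
/-- `∮_{|ζ|=ρ} (h' - h) = 0` for `0 < ρ ≤ ρ₀` (Cauchy–Goursat). [folklore] -/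
theorem circleIntegral_hmapT_sub_hmap {ρ : ℝ} (hρ : 0 < ρ) (hρ1 : ρ ≤ ρ₀) :
    (∮ ζ in C(0, ρ), (hmapT Φ' (U u) ζ - hmap Φ ζ)) = 0 := by
  have hD := differentiableOn_hmapT_sub_hmap hB hΦ hd hU hU0 hu hS hρ₀ hBρ hη hΦ'
  have hcl : closedBall (0 : ℂ) ρ ⊆ ball (0 : ℂ) (4 * ρ₀) := closedBall_subset_ball (by linarith)
  refine Complex.circleIntegral_eq_zero_of_differentiable_on_off_countable hρ.le countable_empty
    (hD.continuousOn.mono hcl) fun z hz ↦ ?_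
  exact hD.differentiableAt (isOpen_ball.mem_nhds (hcl (ball_subset_closedBall hz.1)))

include hB hΦ hd hρ₀ hBρ in
/-- **`∮_{|ζ|=ρ} dζ/E_B(ζ) = 2πi/d`** for `0 < ρ ≤ ρ₀`: `q(ζ) = ζ/E_B(ζ)` has a removable
singularity at `0` with `q(0) = 1/d`, and `1/E_B(ζ) = q(ζ)/ζ` (Cauchy's integral formula).
[folklore] -/
theorem circleIntegral_inv_hullExt {ρ : ℝ} (hρ : 0 < ρ) (hρ1 : ρ ≤ ρ₀) :
    (∮ ζ in C(0, ρ), (hullExt Φ ζ)⁻¹) = (2 * π * I) * (d : ℂ)⁻¹ := by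
  obtain ⟨hsub, hE, -⟩ := differentiableOn_hmap hB hΦ hρ₀ hBρ
  have hd0 := (restrictionDeriv_pos_le_one hB hΦ hd).1
  set q : ℂ → ℂ := fun ζ ↦ if ζ = 0 then (d : ℂ)⁻¹ else ζ / hullExt Φ ζ with hq
  -- `q` is holomorphic on `B(0, 4ρ₀)`: off `0` by the quotient rule, at `0` removable
  have hne : ∀ ζ ∈ ball (0 : ℂ) (4 * ρ₀), ζ ≠ 0 → hullExt Φ ζ ≠ 0 := fun ζ hζ hζ0 ↦
    hullExt_ne_zero hB hΦ hd hρ₀ hBρ hζ hζ0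
  have hqdiff : DifferentiableOn ℂ q (ball (0 : ℂ) (4 * ρ₀)) := by
    have h0 : ball (0 : ℂ) (4 * ρ₀) ∈ 𝓝 (0 : ℂ) := isOpen_ball.mem_nhds (mem_ball_self (by positivity))
    refine (Complex.differentiableOn_compl_singleton_and_continuousAt_iff h0).1 ⟨?_, ?_⟩
    · intro ζ hζ
      have hζ0 : ζ ≠ 0 := hζ.2
      have hev : q =ᶠ[𝓝 ζ] fun w ↦ w / hullExt Φ w := by
        filter_upwards [isOpen_ne.mem_nhds hζ0] with w hw
        simp [hq, hw]
      refine (DifferentiableAt.congr_of_eventuallyEq ?_ hev).differentiableWithinAt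
      exact (differentiableAt_id.div (hE.differentiableAt (isOpen_ball.mem_nhds hζ.1)) (hne ζ hζ.1 hζ0))
    · -- continuity at `0`: `ζ/E(ζ) → 1/d`
      rw [← continuousWithinAt_compl_self, ContinuousWithinAt]
      have hder : HasDerivAt (hullExt Φ) d 0 := hasDerivAt_hullExt_zero hB hΦ hd
      have hsl := hder.tendsto_slope_zero
      simp only [zero_add, hullExt_zero hB hΦ, sub_zero] at hsl
      have hinv := hsl.inv₀ (ofReal_ne_zero.2 hd0.ne')
      have hq0 : q 0 = (d : ℂ)⁻¹ := by simp [hq]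
      rw [hq0]
      refine hinv.congr' ?_
      filter_upwards [self_mem_nhdsWithin] with w hw
      simp only [mem_compl_iff, mem_singleton_iff] at hw
      simp [hq, hw, smul_eq_mul, inv_inv, div_eq_mul_inv, mul_comm]
  have hqc : DiffContOnCl ℂ q (ball (0 : ℂ) ρ) := by
    refine DifferentiableOn.diffContOnCl ?_
    rw [closure_ball 0 hρ.ne']
    exact hqdiff.mono (closedBall_subset_ball (by linarith))
  have hC := hqc.circleIntegral_sub_inv_smul (mem_ball_self hρ)
  have hq0 : q 0 = (d : ℂ)⁻¹ := by simp [hq]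
  rw [hq0] at hC
  rw [← smul_eq_mul, ← hC]
  refine circleIntegral.integral_congr hρ.le fun ζ hζ ↦ ?_
  have hζ0 : ζ ≠ 0 := by
    intro h; rw [h, mem_sphere, dist_self] at hζ; exact hρ.ne' hζ.symm
  simp only [hq, hζ0, if_false, sub_zero, smul_eq_mul]
  field_simp

include hB hΦ hd hU hU0 hu hS hρ₀ hBρ hη hΦ' in
/-- `∮_{|ζ|=ρ} E_{B'}'(ζ - U_u) · (2u/ζ) dζ = 2πi · 2u · E_{B'}'(-U_u)` for `0 < ρ ≤ ρ₀` (Cauchy's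
integral formula). [folklore] -/
theorem circleIntegral_deriv_mul_div {ρ : ℝ} (hρ : 0 < ρ) (hρ1 : ρ ≤ ρ₀) :
    (∮ ζ in C(0, ρ), deriv (hullExt Φ') (ζ - U u) * (2 * (u : ℂ) / ζ)) =
      (2 * π * I) * (2 * (u : ℂ) * deriv (hullExt Φ') (-(U u : ℂ))) := by
  obtain ⟨hsub, hdiff⟩ := ball_subset_symmDomain_slid hB hΦ hd hU hU0 hu hS hρ₀ hBρ hη hΦ'
  obtain ⟨-, -, hη0, hη1, -⟩ := stepSize_small hB hΦ hd hu hS hρ₀ hη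
  have hUu : |U u| ≤ stepSize S u := by
    have := hS u le_rfl; rw [stepSize]; have := Real.sqrt_nonneg (u : ℝ); linarith
  have hd' : DifferentiableOn ℂ (deriv (hullExt Φ')) (ball (0 : ℂ) (6 * ρ₀)) :=
    ((hdiff.analyticOnNhd isOpen_ball).deriv).differentiableOn
  set D1 : ℂ → ℂ := fun w ↦ 2 * (u : ℂ) * deriv (hullExt Φ') (w - U u) with hD1
  have hD1d : DifferentiableOn ℂ D1 (ball (0 : ℂ) (2 * ρ₀)) := by
    intro w hw
    have hw6 : w - U u ∈ ball (0 : ℂ) (6 * ρ₀) := by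
      rw [mem_ball_zero_iff] at hw ⊢
      calc ‖w - U u‖ ≤ ‖w‖ + ‖((U u : ℝ) : ℂ)‖ := norm_sub_le _ _
        _ < 6 * ρ₀ := by rw [norm_real, Real.norm_eq_abs]; linarith
    exact ((((hd'.differentiableAt (isOpen_ball.mem_nhds hw6)).hasDerivAt).comp_sub_const w
      (U u : ℂ)).differentiableAt.const_mul _).differentiableWithinAt
  have hqc : DiffContOnCl ℂ D1 (ball (0 : ℂ) ρ) := by
    refine DifferentiableOn.diffContOnCl ?_
    rw [closure_ball 0 hρ.ne']
    exact hD1d.mono (closedBall_subset_ball (by linarith))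
  have hC := hqc.circleIntegral_sub_inv_smul (mem_ball_self hρ)
  simp only [hD1, zero_sub, sub_zero, smul_eq_mul] at hC
  rw [← hC]
  refine circleIntegral.integral_congr hρ.le fun ζ hζ ↦ ?_
  have hζ0 : ζ ≠ 0 := by
    intro h; rw [h, mem_sphere, dist_self] at hζ; exact hρ.ne' hζ.symm
  field_simp

/-! ### The capacity identity `a ≈ 2 d u E_{B'}'(-U_u)` and the bound `a ≤ 6 d u` -/

include hB hΦ hd hU hU0 hu hS hρ₀ hBρ hη hΦ' in
/-- **Lawler's capacity identity, quantitative form**: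
`|a/d - 2u E_{B'}'(-U_u)| ≤ 192 a η/(d² ρ₀) + 32 u η/ρ₀ + 128 u²/ρ₀²` (integrate the circle
identity over `|ζ| = ρ₀`). [cite: Lawler2005, §4.6.1 proof of Prop. 4.40 with (4.15)] -/
theorem norm_stepCap_div_sub_le :
    ‖(stepCap Φ Φ' (2 * stepSize S u) : ℂ) / d - 2 * (u : ℂ) * deriv (hullExt Φ') (-(U u : ℂ))‖ ≤
      192 * stepCap Φ Φ' (2 * stepSize S u) * stepSize S u / (d ^ 2 * ρ₀) +
        32 * u * stepSize S u / ρ₀ + 128 * u ^ 2 / ρ₀ ^ 2 := by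
  obtain ⟨hd0, hd1, hη0, hη1, huη, huρ⟩ := stepSize_small hB hΦ hd hu hS hρ₀ hη
  set a : ℝ := stepCap Φ Φ' (2 * stepSize S u) with ha
  set η : ℝ := stepSize S u with hηdef
  set εR : ℝ := 192 * a * η / (d ^ 2 * ρ₀ ^ 2) + 32 * u * η / ρ₀ ^ 2 + 128 * u ^ 2 / ρ₀ ^ 3 with hεR
  -- the four functions on the circle
  set Δ : ℂ → ℂ := fun w ↦ hmapT Φ' (U u) w - hmap Φ w with hΔ
  set P : ℂ → ℂ := fun w ↦ (a : ℂ) / hullExt Φ w with hP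
  set T : ℂ → ℂ := fun w ↦ deriv (hullExt Φ') (w - U u) * (2 * (u : ℂ) / w) with hT
  have hbound : ∀ ζ ∈ sphere (0 : ℂ) ρ₀, ‖Δ ζ - P ζ + T ζ‖ ≤ εR := fun ζ hζ ↦ by
    have hζ' : ‖ζ‖ = ρ₀ := by simpa using hζ
    have := (norm_sub_hmap_circle_le hB hΦ hd hU hU0 hu hS hρ₀ hBρ hη hΦ' (ρ := ρ₀) (by linarith)
      le_rfl hζ').2
    simp only [hΔ, hP, hT, hεR]
    convert this using 2
    ring
  -- continuity on the sphere (for integrability)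
  obtain ⟨hsub, hE, -⟩ := differentiableOn_hmap hB hΦ hρ₀ hBρ
  have hsph : sphere (0 : ℂ) ρ₀ ⊆ ball (0 : ℂ) (4 * ρ₀) := sphere_subset_closedBall.trans
    (closedBall_subset_ball (by linarith))
  have hΔc : ContinuousOn Δ (sphere (0 : ℂ) ρ₀) :=
    (differentiableOn_hmapT_sub_hmap hB hΦ hd hU hU0 hu hS hρ₀ hBρ hη hΦ').continuousOn.mono hsph
  have hne : ∀ ζ ∈ sphere (0 : ℂ) ρ₀, ζ ≠ 0 ∧ hullExt Φ ζ ≠ 0 := fun ζ hζ ↦ by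
    have hζ0 : ζ ≠ 0 := by
      intro h; rw [h, mem_sphere, dist_self] at hζ; exact hρ₀.ne' hζ.symm
    exact ⟨hζ0, hullExt_ne_zero hB hΦ hd hρ₀ hBρ (hsph hζ) hζ0⟩
  have hPc : ContinuousOn P (sphere (0 : ℂ) ρ₀) :=
    continuousOn_const.div (hE.continuousOn.mono hsph) fun ζ hζ ↦ (hne ζ hζ).2
  obtain ⟨-, hdiff'⟩ := ball_subset_symmDomain_slid hB hΦ hd hU hU0 hu hS hρ₀ hBρ hη hΦ'
  have hUu : |U u| ≤ η := by
    have := hS u le_rfl; rw [hηdef, stepSize]; have := Real.sqrt_nonneg (u : ℝ); linarith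
  have hTc : ContinuousOn T (sphere (0 : ℂ) ρ₀) := by
    refine ContinuousOn.mul ?_ (continuousOn_const.div continuousOn_id fun ζ hζ ↦ (hne ζ hζ).1)
    have hd' : ContinuousOn (deriv (hullExt Φ')) (ball (0 : ℂ) (6 * ρ₀)) :=
      ((hdiff'.analyticOnNhd isOpen_ball).deriv).continuousOn
    refine hd'.comp (continuousOn_id.sub continuousOn_const) fun ζ hζ ↦ ?_
    rw [mem_ball_zero_iff]
    have hζ' : ‖ζ‖ = ρ₀ := by simpa using hζ
    calc ‖ζ - U u‖ ≤ ‖ζ‖ + ‖((U u : ℝ) : ℂ)‖ := norm_sub_le _ _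
      _ < 6 * ρ₀ := by rw [norm_real, Real.norm_eq_abs]; linarith
  have hiΔ := hΔc.circleIntegrable hρ₀.le
  have hiP := hPc.circleIntegrable hρ₀.le
  have hiT := hTc.circleIntegrable hρ₀.le
  -- the integral of the remainder
  have hI : (∮ ζ in C(0, ρ₀), (Δ ζ - P ζ + T ζ)) =
      -((2 * π * I) * ((a : ℂ) * (d : ℂ)⁻¹)) + (2 * π * I) * (2 * (u : ℂ) * deriv (hullExt Φ') (-(U u : ℂ))) := by
    have hiΔP : CircleIntegrable (fun ζ ↦ Δ ζ - P ζ) 0 ρ₀ := hiΔ.sub hiP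
    rw [circleIntegral.integral_add hiΔP hiT, circleIntegral.integral_sub hiΔ hiP]
    rw [show (∮ ζ in C(0, ρ₀), Δ ζ) = 0 from
      circleIntegral_hmapT_sub_hmap hB hΦ hd hU hU0 hu hS hρ₀ hBρ hη hΦ' hρ₀ le_rfl]
    rw [show (∮ ζ in C(0, ρ₀), P ζ) = (a : ℂ) * ∮ ζ in C(0, ρ₀), (hullExt Φ ζ)⁻¹ by
      rw [← circleIntegral.integral_const_mul]; simp only [hP, div_eq_mul_inv]]
    rw [circleIntegral_inv_hullExt hB hΦ hd hρ₀ hBρ hρ₀ le_rfl,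
      circleIntegral_deriv_mul_div hB hΦ hd hU hU0 hu hS hρ₀ hBρ hη hΦ' hρ₀ le_rfl]
    ring
  have hnorm := circleIntegral.norm_integral_le_of_norm_le_const hρ₀.le hbound
  rw [hI, show -((2 * π * I) * ((a : ℂ) * (d : ℂ)⁻¹)) + (2 * π * I) * (2 * (u : ℂ) * deriv (hullExt Φ') (-(U u : ℂ)))
      = (2 * π * I : ℂ) * (2 * (u : ℂ) * deriv (hullExt Φ') (-(U u : ℂ)) - (a : ℂ) / d) by ring,
    norm_mul, show ‖(2 * π * I : ℂ)‖ = 2 * π by simp [Real.pi_pos.le]] at hnorm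
  -- divide by `2π`
  have h2π : (0 : ℝ) < 2 * π := by positivity
  have hfin : ‖2 * (u : ℂ) * deriv (hullExt Φ') (-(U u : ℂ)) - (a : ℂ) / d‖ ≤ ρ₀ * εR :=
    le_of_mul_le_mul_left (by linarith [hnorm]) h2π
  rw [norm_sub_rev] at hfin
  refine hfin.trans (le_of_eq ?_)
  simp only [hεR]
  field_simp


include hB hΦ hd hU hU0 hu hS hρ₀ hBρ hη hΦ' in
/-- **`a ≤ 5 d u`** and **`|a/d - 2u E_{B'}'(-U_u)| ≤ u (1000 η/(dρ₀) + 128 u/ρ₀²)`**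
(absorb the `a`-term of `norm_stepCap_div_sub_le` using `η ≤ dρ₀/1000`, `|E_{B'}'| ≤ 2`).
[cite: Lawler2005, §4.6.1 proof of Prop. 4.40 with (4.15)] -/
theorem stepCap_le : stepCap Φ Φ' (2 * stepSize S u) ≤ 5 * d * u ∧
    ‖(stepCap Φ Φ' (2 * stepSize S u) : ℂ) / d - 2 * (u : ℂ) * deriv (hullExt Φ') (-(U u : ℂ))‖ ≤
      u * (1000 * stepSize S u / (d * ρ₀) + 128 * u / ρ₀ ^ 2) := by
  obtain ⟨hd0, hd1, hη0, hη1, huη, huρ⟩ := stepSize_small hB hΦ hd hu hS hρ₀ hη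
  have hkey := norm_stepCap_div_sub_le hB hΦ hd hU hU0 hu hS hρ₀ hBρ hη hΦ'
  set a : ℝ := stepCap Φ Φ' (2 * stepSize S u) with ha
  set η : ℝ := stepSize S u with hηdef
  have ha0 : 0 ≤ a := (norm_sub_hmap_circle_le hB hΦ hd hU hU0 hu hS hρ₀ hBρ hη hΦ' (ρ := ρ₀)
    (by linarith) le_rfl (ζ := (ρ₀ : ℂ)) (by simp [hρ₀.le])).1
  have hUu : |U u| ≤ η := by
    have := hS u le_rfl; rw [hηdef, stepSize]; have := Real.sqrt_nonneg (u : ℝ); linarith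
  have hD1 : ‖deriv (hullExt Φ') (-(U u : ℂ))‖ ≤ 2 := by
    refine norm_deriv_hullExt_slid_le_two hB hΦ hd hU hU0 hu hS hρ₀ hBρ hη hΦ' ?_
    rw [mem_ball_zero_iff, norm_neg, norm_real, Real.norm_eq_abs]; linarith
  have h2u : ‖2 * (u : ℂ) * deriv (hullExt Φ') (-(U u : ℂ))‖ ≤ 4 * u := by
    rw [norm_mul, norm_mul, Complex.norm_two, Complex.norm_of_nonneg u.coe_nonneg]
    nlinarith [u.coe_nonneg, norm_nonneg (deriv (hullExt Φ') (-(U u : ℂ)))]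
  have had : ‖((a : ℂ)) / d‖ = a / d := by
    rw [norm_div, norm_real, norm_real, Real.norm_of_nonneg ha0, Real.norm_of_nonneg hd0.le]
  -- `a/d ≤ 4u + (bound)`
  have h1 : a / d ≤ 4 * u + (192 * a * η / (d ^ 2 * ρ₀) + 32 * u * η / ρ₀ + 128 * u ^ 2 / ρ₀ ^ 2) := by
    have := norm_le_norm_add_norm_sub' ((a : ℂ) / d) (2 * (u : ℂ) * deriv (hullExt Φ') (-(U u : ℂ)))
    rw [had] at this
    linarith
  -- absorb: `192 a η/(d² ρ₀) ≤ 0.192 a/d`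
  have h2 : 192 * a * η / (d ^ 2 * ρ₀) ≤ 192 / 1000 * (a / d) := by
    rw [div_le_iff₀ (by positivity)]
    have : a * η ≤ a * (d * ρ₀ / 1000) := mul_le_mul_of_nonneg_left hη ha0
    have hda : 192 / 1000 * (a / d) * (d ^ 2 * ρ₀) = 192 * (a * (d * ρ₀ / 1000)) := by
      field_simp
    nlinarith
  have h3 : 32 * u * η / ρ₀ ≤ 32 / 1000 * u := by
    rw [div_le_iff₀ hρ₀]
    have : (u : ℝ) * η ≤ u * (ρ₀ / 1000) := mul_le_mul_of_nonneg_left (by linarith) u.coe_nonneg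
    nlinarith
  have h4 : 128 * u ^ 2 / ρ₀ ^ 2 ≤ 128 / 10 ^ 6 * u := by
    rw [div_le_iff₀ (by positivity)]
    have : (u : ℝ) * u ≤ u * (ρ₀ ^ 2 / 10 ^ 6) := mul_le_mul_of_nonneg_left huρ u.coe_nonneg
    nlinarith
  have h5 : a / d ≤ 5 * u := by
    have hu0 : (0 : ℝ) ≤ u := u.coe_nonneg
    nlinarith [h1, h2, h3, h4, hu0, ha0, hd0]
  have h6 : a ≤ 5 * d * u := by
    have := (div_le_iff₀ hd0).1 h5; linarith
  refine ⟨h6, hkey.trans ?_⟩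
  have h7 : 192 * a * η / (d ^ 2 * ρ₀) ≤ 960 * u * η / (d * ρ₀) := by
    rw [div_le_div_iff₀ (by positivity) (by positivity)]
    have := mul_le_mul_of_nonneg_right h6 (by positivity : 0 ≤ 192 * η * (d * ρ₀))
    nlinarith [this]
  have h8 : 32 * u * η / ρ₀ ≤ 40 * u * η / (d * ρ₀) := by
    rw [div_le_div_iff₀ hρ₀ (by positivity)]
    have := mul_le_mul_of_nonneg_left hd1 (by positivity : 0 ≤ 32 * u * η * ρ₀)
    nlinarith [this, mul_nonneg (mul_nonneg u.coe_nonneg hη0.le) hρ₀.le]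
  have h9 : u * (1000 * η / (d * ρ₀) + 128 * u / ρ₀ ^ 2) =
      960 * u * η / (d * ρ₀) + 40 * u * η / (d * ρ₀) + 128 * u ^ 2 / ρ₀ ^ 2 := by ring
  rw [h9]; linarith

include hB hΦ hd hU hU0 hu hS hρ₀ hBρ hη hΦ' in
/-- **`|h'(z) - h(z)| ≤ 25 u/ρ₀` for `|z| ≤ ρ₀`** (the bound on the circle `|ζ| = ρ₀` from the
circle identity with `a ≤ 5du`, `|E_B| ≥ dρ₀/4`, `|E_{B'}'| ≤ 2`, and the maximum modulus
principle): `t ↦ h_t(z)` is Lipschitz. [cite: LawlerSchrammWerner2003Restriction, §5 (5.2);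
Lawler2005, Prop. 4.40] -/
theorem norm_hmapT_sub_hmap_le {z : ℂ} (hz : ‖z‖ ≤ ρ₀) :
    ‖hmapT Φ' (U u) z - hmap Φ z‖ ≤ 25 * u / ρ₀ := by
  obtain ⟨hd0, hd1, hη0, hη1, huη, huρ⟩ := stepSize_small hB hΦ hd hu hS hρ₀ hη
  obtain ⟨ha5, -⟩ := stepCap_le hB hΦ hd hU hU0 hu hS hρ₀ hBρ hη hΦ'
  set a : ℝ := stepCap Φ Φ' (2 * stepSize S u) with ha
  set η : ℝ := stepSize S u with hηdef
  have hUu : |U u| ≤ η := by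
    have := hS u le_rfl; rw [hηdef, stepSize]; have := Real.sqrt_nonneg (u : ℝ); linarith
  -- bound on the sphere
  have hsph : ∀ ζ ∈ frontier (ball (0 : ℂ) ρ₀), ‖hmapT Φ' (U u) ζ - hmap Φ ζ‖ ≤ 25 * u / ρ₀ := by
    rw [frontier_ball 0 hρ₀.ne']
    intro ζ hζ
    have hζ' : ‖ζ‖ = ρ₀ := by simpa using hζ
    obtain ⟨ha0, hcirc⟩ := norm_sub_hmap_circle_le hB hΦ hd hU hU0 hu hS hρ₀ hBρ hη hΦ' (ρ := ρ₀)
      (by linarith) le_rfl hζ'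
    have hζ4 : ζ ∈ ball (0 : ℂ) (4 * ρ₀) := mem_ball_zero_iff.2 (by linarith)
    have hEz : d * ρ₀ / 4 ≤ ‖hullExt Φ ζ‖ := norm_hullExt_ge hB hΦ hd hρ₀ hBρ hρ₀ (by linarith) hζ4 hζ'.ge
    have hEpos : 0 < ‖hullExt Φ ζ‖ := lt_of_lt_of_le (by positivity) hEz
    have hD1 : ‖deriv (hullExt Φ') (ζ - U u)‖ ≤ 2 := by
      refine norm_deriv_hullExt_slid_le_two hB hΦ hd hU hU0 hu hS hρ₀ hBρ hη hΦ' ?_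
      rw [mem_ball_zero_iff]
      calc ‖ζ - U u‖ ≤ ‖ζ‖ + ‖((U u : ℝ) : ℂ)‖ := norm_sub_le _ _
        _ < 3 * ρ₀ := by rw [norm_real, Real.norm_eq_abs]; linarith
    have hP : ‖(a : ℂ) / hullExt Φ ζ‖ ≤ 20 * u / ρ₀ := by
      rw [norm_div, norm_real, Real.norm_of_nonneg ha0, div_le_div_iff₀ hEpos hρ₀]
      have := mul_le_mul ha5 hEz (by positivity) (by positivity)
      nlinarith [this]
    have hζ0 : 0 < ‖ζ‖ := by rw [hζ']; exact hρ₀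
    have hT : ‖deriv (hullExt Φ') (ζ - U u) * (2 * (u : ℂ) / ζ)‖ ≤ 4 * u / ρ₀ := by
      rw [norm_mul, norm_div, norm_mul, Complex.norm_two, Complex.norm_of_nonneg u.coe_nonneg, hζ']
      rw [show 4 * (u : ℝ) / ρ₀ = 2 * (2 * u / ρ₀) by ring]
      exact mul_le_mul hD1 le_rfl (by positivity) (by norm_num)
    have hR : 192 * a * η / (d ^ 2 * ρ₀ ^ 2) + 32 * u * η / ρ₀ ^ 2 + 128 * u ^ 2 / ρ₀ ^ 3 ≤ u / ρ₀ := by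
      have e1 : 192 * a * η / (d ^ 2 * ρ₀ ^ 2) ≤ 960 / 1000 * (u / ρ₀) := by
        rw [div_le_iff₀ (by positivity)]
        have := mul_le_mul ha5 hη (by positivity) (by positivity)
        have h' : 960 / 1000 * (u / ρ₀) * (d ^ 2 * ρ₀ ^ 2) = 192 * (5 * d * u * (d * ρ₀ / 1000)) * 1 := by
          field_simp; ring
        nlinarith [this]
      have e2 : 32 * u * η / ρ₀ ^ 2 ≤ 32 / 1000 * (u / ρ₀) := by
        rw [div_le_iff₀ (by positivity)]
        have : (u : ℝ) * η ≤ u * (ρ₀ / 1000) := mul_le_mul_of_nonneg_left (by linarith) u.coe_nonneg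
        have h' : 32 / 1000 * (u / ρ₀) * ρ₀ ^ 2 = 32 * (u * (ρ₀ / 1000)) := by field_simp
        nlinarith
      have e3 : 128 * u ^ 2 / ρ₀ ^ 3 ≤ 128 / 10 ^ 6 * (u / ρ₀) := by
        rw [div_le_iff₀ (by positivity)]
        have : (u : ℝ) * u ≤ u * (ρ₀ ^ 2 / 10 ^ 6) := mul_le_mul_of_nonneg_left huρ u.coe_nonneg
        have h' : 128 / 10 ^ 6 * (u / ρ₀) * ρ₀ ^ 3 = 128 * (u * (ρ₀ ^ 2 / 10 ^ 6)) := by field_simp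
        nlinarith
      have : 0 ≤ (u : ℝ) / ρ₀ := by positivity
      linarith
    calc ‖hmapT Φ' (U u) ζ - hmap Φ ζ‖
        ≤ ‖(hmapT Φ' (U u) ζ - hmap Φ ζ) - ((a : ℂ) / hullExt Φ ζ - deriv (hullExt Φ') (ζ - U u) * (2 * (u : ℂ) / ζ))‖ +
          ‖(a : ℂ) / hullExt Φ ζ - deriv (hullExt Φ') (ζ - U u) * (2 * (u : ℂ) / ζ)‖ := norm_le_norm_sub_add _ _
      _ ≤ u / ρ₀ + (20 * u / ρ₀ + 4 * u / ρ₀) := by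
          gcongr
          · exact hcirc.trans hR
          · exact (norm_sub_le _ _).trans (add_le_add hP hT)
      _ = 25 * u / ρ₀ := by ring
  have hD := differentiableOn_hmapT_sub_hmap hB hΦ hd hU hU0 hu hS hρ₀ hBρ hη hΦ'
  have hdc : DiffContOnCl ℂ (fun w ↦ hmapT Φ' (U u) w - hmap Φ w) (ball (0 : ℂ) ρ₀) := by
    refine DifferentiableOn.diffContOnCl ?_
    rw [closure_ball 0 hρ₀.ne']
    exact hD.mono (closedBall_subset_ball (by linarith))
  have hzcl : z ∈ closure (ball (0 : ℂ) ρ₀) := by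
    rw [closure_ball 0 hρ₀.ne']; exact mem_closedBall_zero_iff.2 hz
  exact Complex.norm_le_of_forall_mem_frontier_norm_le isBounded_ball hdc hsph hzcl

include hB hΦ hd hU hU0 hu hS hρ₀ hBρ hη hΦ' in
/-- **`|(h' - h)'(z)| ≤ 50 u/ρ₀²` for `|z| ≤ ρ₀/2`** (Cauchy estimate). In particular (at `z = 0`)
`|E_{B'}'(-U_u) - d| ≤ 50 u/ρ₀²`. [folklore] -/
theorem norm_deriv_hmapT_sub_hmap_le {z : ℂ} (hz : ‖z‖ ≤ ρ₀ / 2) :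
    ‖deriv (hullExt Φ') (z - U u) - deriv (hullExt Φ) z‖ ≤ 50 * u / ρ₀ ^ 2 := by
  have hD := differentiableOn_hmapT_sub_hmap hB hΦ hd hU hU0 hu hS hρ₀ hBρ hη hΦ'
  have hz4 : z ∈ ball (0 : ℂ) (4 * ρ₀) := mem_ball_zero_iff.2 (by linarith)
  rw [← (hasDerivAt_hmapT_sub_hmap hB hΦ hd hU hU0 hu hS hρ₀ hBρ hη hΦ' hz4).deriv]
  have hcl : closedBall z (ρ₀ / 2) ⊆ closedBall (0 : ℂ) ρ₀ := by
    intro w hw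
    rw [mem_closedBall, dist_eq_norm] at hw
    rw [mem_closedBall_zero_iff]
    calc ‖w‖ = ‖(w - z) + z‖ := by ring_nf
      _ ≤ ‖w - z‖ + ‖z‖ := norm_add_le _ _
      _ ≤ ρ₀ := by linarith
  have h := Complex.norm_deriv_le_of_forall_mem_sphere_norm_le (f := fun w ↦ hmapT Φ' (U u) w - hmap Φ w)
    (c := z) (R := ρ₀ / 2) (C := 25 * u / ρ₀) (by positivity) ?_ fun w hw ↦ ?_
  · refine h.trans (le_of_eq ?_); field_simp; ring
  · refine DifferentiableOn.diffContOnCl ?_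
    rw [closure_ball z (by positivity)]
    exact hD.mono (hcl.trans (closedBall_subset_ball (by linarith)))
  · exact norm_hmapT_sub_hmap_le hB hΦ hd hU hU0 hu hS hρ₀ hBρ hη hΦ'
      (mem_closedBall_zero_iff.1 (hcl (sphere_subset_closedBall hw)))


/-! ### The first-order expansion `h' - h = 2u D + O(u(η + u))` -/

/-- **The drift function** `D(z) = (2πi)⁻¹ ∮_{|ζ|=ρ₀/2} (d²/E_B(ζ) - E_B'(ζ)/ζ) dζ/(ζ - z)`: the
holomorphic function on `B(0, ρ₀/2)` that equals `d²/E_B(z) - E_B'(z)/z` off `0` (removable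
singularity at `0`). In the original coordinates (`E_B(z) = h_t(z + W_t) - h_t(W_t)`, `d = h_t'(W_t)`)
`2 D` is the right side `2 h_t'(W_t)²/(h_t(z) - h_t(W_t)) - 2 h_t'(z)/(z - W_t)` of
`∂_t h_t(z)` in Lawler's Prop. 4.40. [cite: Lawler2005, Prop. 4.40] -/
def driftFun (Φ : ConformalEquiv (upperHalfPlaneSet \ B) upperHalfPlaneSet) (d ρ₀ : ℝ) (z : ℂ) : ℂ :=
  (2 * π * I)⁻¹ • ∮ ζ in C(0, ρ₀ / 2),
    (ζ - z)⁻¹ • ((d : ℂ) ^ 2 / hullExt Φ ζ - deriv (hullExt Φ) ζ / ζ)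

/-- The explicit bound `M(a, u, η, d, ρ₀)` on `|ζ| = ρ₀/2` for
`(h' - h)(ζ) - 2u (d²/E_B(ζ) - E_B'(ζ)/ζ)`: circle remainder at radius `ρ₀/2`, plus
`|a - 2ud²| · 8/(dρ₀)`, plus `2u · |(h' - h)'| · 2/ρ₀`. [folklore] -/
def stepErr (a u η d ρ₀ : ℝ) : ℝ :=
  (192 * a * η / (d ^ 2 * (ρ₀ / 2) ^ 2) + 32 * u * η / ρ₀ ^ 2 + 128 * u ^ 2 / ρ₀ ^ 3) +
    (d * (u * (1000 * η / (d * ρ₀) + 128 * u / ρ₀ ^ 2)) + 2 * u * d * (50 * u / ρ₀ ^ 2)) *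
      (8 / (d * ρ₀)) +
    2 * u * (50 * u / ρ₀ ^ 2) * (2 / ρ₀)

/-- `2 M ≤ 25000 u (η ρ₀ + u)/(d ρ₀³)` (elementary, using `a ≤ 5du`, `d ≤ 1`). [folklore] -/
theorem two_stepErr_le (hd0 : 0 < d) (hd1 : d ≤ 1) (hρ₀ : 0 < ρ₀) {a u' η : ℝ} (hu0 : 0 ≤ u')
    (hη0 : 0 < η) (ha5 : a ≤ 5 * d * u') :
    2 * stepErr a u' η d ρ₀ ≤ 25000 * u' * (η * ρ₀ + u') / (d * ρ₀ ^ 3) := by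
  have F1 : u' * η / (d * ρ₀ ^ 2) + u' ^ 2 / (d * ρ₀ ^ 3) = u' * (η * ρ₀ + u') / (d * ρ₀ ^ 3) := by
    field_simp
  have F2 : 0 ≤ u' ^ 2 / (d * ρ₀ ^ 3) := by positivity
  have G1 : u' * η / ρ₀ ^ 2 ≤ u' * η / (d * ρ₀ ^ 2) := by
    rw [div_le_div_iff₀ (by positivity) (by positivity)]
    have := mul_le_mul_of_nonneg_left hd1 (by positivity : (0 : ℝ) ≤ u' * η * ρ₀ ^ 2)
    nlinarith [this]
  have G2 : u' ^ 2 / ρ₀ ^ 3 ≤ u' ^ 2 / (d * ρ₀ ^ 3) := by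
    rw [div_le_div_iff₀ (by positivity) (by positivity)]
    have := mul_le_mul_of_nonneg_left hd1 (by positivity : (0 : ℝ) ≤ u' ^ 2 * ρ₀ ^ 3)
    nlinarith [this]
  have A1 : 192 * a * η / (d ^ 2 * (ρ₀ / 2) ^ 2) ≤ 3840 * (u' * η / (d * ρ₀ ^ 2)) := by
    rw [mul_div_assoc', div_le_div_iff₀ (by positivity) (by positivity)]
    have := mul_le_mul_of_nonneg_right ha5 (by positivity : (0 : ℝ) ≤ 192 * η * (d * ρ₀ ^ 2))
    nlinarith [this]
  have A2 : (d * (u' * (1000 * η / (d * ρ₀) + 128 * u' / ρ₀ ^ 2)) + 2 * u' * d * (50 * u' / ρ₀ ^ 2)) *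
      (8 / (d * ρ₀)) = 8000 * (u' * η / (d * ρ₀ ^ 2)) + 1824 * (u' ^ 2 / ρ₀ ^ 3) := by
    field_simp
    ring
  have A3 : 2 * u' * (50 * u' / ρ₀ ^ 2) * (2 / ρ₀) = 200 * (u' ^ 2 / ρ₀ ^ 3) := by
    field_simp
    ring
  have A4 : 32 * u' * η / ρ₀ ^ 2 = 32 * (u' * η / ρ₀ ^ 2) := by ring
  have A5 : 128 * u' ^ 2 / ρ₀ ^ 3 = 128 * (u' ^ 2 / ρ₀ ^ 3) := by ring
  have A6 : 25000 * u' * (η * ρ₀ + u') / (d * ρ₀ ^ 3) = 25000 * (u' * (η * ρ₀ + u') / (d * ρ₀ ^ 3)) := by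
    ring
  rw [stepErr, A2, A3, A4, A5, A6]
  have hX0 : 0 ≤ u' * η / (d * ρ₀ ^ 2) := by positivity
  linarith [F1, F2, G1, G2, A1, hX0]

include hB hΦ hd hU hU0 hu hS hρ₀ hBρ hη hΦ' in
/-- **The bound on the sphere `|ζ| = ρ₀/2`**: for `|z| ≤ ρ₀/4`,
`|(ζ - z)⁻¹ ((h' - h)(ζ) - 2u (d²/E_B(ζ) - E_B'(ζ)/ζ))| ≤ (4/ρ₀) M`, decomposing
`(h' - h)(ζ) - 2u (d²/E_B - E_B'/ζ) = [circle remainder] + (a - 2ud²)/E_B(ζ) - 2u (h' - h)'(ζ)/ζ`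
with `|a - 2ud²| ≤ d |a/d - 2u E_{B'}'(-U_u)| + 2ud |E_{B'}'(-U_u) - d|`,
`E_{B'}'(-U_u) - d = (h' - h)'(0)`. [cite: Lawler2005, Prop. 4.40 (proof)] -/
theorem norm_smul_sub_drift_le {z ζ : ℂ} (hz : ‖z‖ ≤ ρ₀ / 4) (hζ : ζ ∈ sphere (0 : ℂ) (ρ₀ / 2)) :
    ‖(ζ - z)⁻¹ • ((hmapT Φ' (U u) ζ - hmap Φ ζ) -
        2 * (u : ℂ) * ((d : ℂ) ^ 2 / hullExt Φ ζ - deriv (hullExt Φ) ζ / ζ))‖ ≤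
      4 / ρ₀ * stepErr (stepCap Φ Φ' (2 * stepSize S u)) u (stepSize S u) d ρ₀ := by
  obtain ⟨hd0, hd1, hη0, hη1, huη, huρ⟩ := stepSize_small hB hΦ hd hu hS hρ₀ hη
  obtain ⟨ha5, hcap⟩ := stepCap_le hB hΦ hd hU hU0 hu hS hρ₀ hBρ hη hΦ'
  have hρ2 : 0 < ρ₀ / 2 := by positivity
  have hUu : |U u| ≤ stepSize S u := by
    have := hS u le_rfl; rw [stepSize]; have := Real.sqrt_nonneg (u : ℝ); linarith
  have hζ' : ‖ζ‖ = ρ₀ / 2 := by simpa using hζ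
  have hζ0 : ζ ≠ 0 := by intro h; rw [h, norm_zero] at hζ'; linarith
  have hζ4 : ζ ∈ ball (0 : ℂ) (4 * ρ₀) := mem_ball_zero_iff.2 (by linarith)
  have hEζ0 : hullExt Φ ζ ≠ 0 := hullExt_ne_zero hB hΦ hd hρ₀ hBρ hζ4 hζ0
  have hζz : ζ - z ≠ 0 := by
    intro h; rw [sub_eq_zero] at h; rw [h] at hζ'; linarith
  -- `‖(ζ - z)⁻¹‖ ≤ 4/ρ₀`
  have hinv : ‖(ζ - z)⁻¹‖ ≤ 4 / ρ₀ := by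
    rw [norm_inv, inv_eq_one_div, div_le_div_iff₀ (norm_pos_iff.2 hζz) hρ₀]
    have h' : ‖ζ‖ - ‖z‖ ≤ ‖ζ - z‖ := by
      have := abs_norm_sub_norm_le ζ z
      have := le_abs_self (‖ζ‖ - ‖z‖)
      linarith
    nlinarith
  -- piece 1: the circle remainder at radius `ρ₀/2`
  obtain ⟨ha0, hcirc⟩ := norm_sub_hmap_circle_le hB hΦ hd hU hU0 hu hS hρ₀ hBρ hη hΦ' (ρ := ρ₀ / 2)
    le_rfl (by linarith) hζ'
  -- piece 2: `(a - 2ud²)/E_B(ζ)`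
  have hD10 : ‖deriv (hullExt Φ') (-(U u : ℂ)) - d‖ ≤ 50 * u / ρ₀ ^ 2 := by
    have := norm_deriv_hmapT_sub_hmap_le hB hΦ hd hU hU0 hu hS hρ₀ hBρ hη hΦ' (z := 0)
      (by rw [norm_zero]; positivity)
    rwa [zero_sub, deriv_hullExt_zero hB hΦ hd] at this
  have ha2 : ‖(stepCap Φ Φ' (2 * stepSize S u) : ℂ) - 2 * (u : ℂ) * (d : ℂ) ^ 2‖ ≤
      d * (u * (1000 * stepSize S u / (d * ρ₀) + 128 * u / ρ₀ ^ 2)) + 2 * u * d * (50 * u / ρ₀ ^ 2) := by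
    have hd0' : (d : ℂ) ≠ 0 := ofReal_ne_zero.2 hd0.ne'
    have hid : (stepCap Φ Φ' (2 * stepSize S u) : ℂ) - 2 * (u : ℂ) * (d : ℂ) ^ 2 =
        (d : ℂ) * ((stepCap Φ Φ' (2 * stepSize S u) : ℂ) / d -
            2 * (u : ℂ) * deriv (hullExt Φ') (-(U u : ℂ))) +
          2 * (u : ℂ) * d * (deriv (hullExt Φ') (-(U u : ℂ)) - d) := by
      field_simp; ring
    rw [hid]
    refine (norm_add_le _ _).trans (add_le_add ?_ ?_)
    · rw [norm_mul, norm_real, Real.norm_of_nonneg hd0.le]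
      exact mul_le_mul_of_nonneg_left hcap hd0.le
    · rw [norm_mul, norm_mul, norm_mul, Complex.norm_two, Complex.norm_of_nonneg u.coe_nonneg,
        norm_real, Real.norm_of_nonneg hd0.le]
      exact mul_le_mul_of_nonneg_left hD10 (by positivity)
  have hEz : d * (ρ₀ / 2) / 4 ≤ ‖hullExt Φ ζ‖ :=
    norm_hullExt_ge hB hΦ hd hρ₀ hBρ hρ2 (by linarith) hζ4 hζ'.ge
  have hEpos : 0 < ‖hullExt Φ ζ‖ := norm_pos_iff.2 hEζ0
  have hpiece2 : ‖((stepCap Φ Φ' (2 * stepSize S u) : ℂ) - 2 * (u : ℂ) * (d : ℂ) ^ 2) / hullExt Φ ζ‖ ≤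
      (d * (u * (1000 * stepSize S u / (d * ρ₀) + 128 * u / ρ₀ ^ 2)) + 2 * u * d * (50 * u / ρ₀ ^ 2)) *
        (8 / (d * ρ₀)) := by
    rw [norm_div, div_eq_mul_inv]
    refine mul_le_mul ha2 ?_ (by positivity) (by positivity)
    rw [inv_eq_one_div, div_le_div_iff₀ hEpos (by positivity)]
    linarith
  -- piece 3: `2u (h' - h)'(ζ)/ζ`
  have hderζ := norm_deriv_hmapT_sub_hmap_le hB hΦ hd hU hU0 hu hS hρ₀ hBρ hη hΦ' (z := ζ) hζ'.le
  have hpiece3 : ‖2 * (u : ℂ) * (deriv (hullExt Φ') (ζ - U u) - deriv (hullExt Φ) ζ) / ζ‖ ≤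
      2 * u * (50 * u / ρ₀ ^ 2) * (2 / ρ₀) := by
    rw [norm_div, div_eq_mul_inv, norm_mul, norm_mul, Complex.norm_two,
      Complex.norm_of_nonneg u.coe_nonneg]
    refine mul_le_mul (mul_le_mul_of_nonneg_left hderζ (by positivity)) ?_ (by positivity)
      (by positivity)
    rw [hζ', inv_eq_one_div, div_le_div_iff₀ hρ2 hρ₀]
    linarith
  -- assemble
  have hid : (hmapT Φ' (U u) ζ - hmap Φ ζ) -
      2 * (u : ℂ) * ((d : ℂ) ^ 2 / hullExt Φ ζ - deriv (hullExt Φ) ζ / ζ) =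
      ((hmapT Φ' (U u) ζ - hmap Φ ζ) - ((stepCap Φ Φ' (2 * stepSize S u) : ℂ) / hullExt Φ ζ -
          deriv (hullExt Φ') (ζ - U u) * (2 * (u : ℂ) / ζ))) +
        ((stepCap Φ Φ' (2 * stepSize S u) : ℂ) - 2 * (u : ℂ) * (d : ℂ) ^ 2) / hullExt Φ ζ -
        2 * (u : ℂ) * (deriv (hullExt Φ') (ζ - U u) - deriv (hullExt Φ) ζ) / ζ := by
    field_simp
    ring
  rw [norm_smul, hid]
  refine mul_le_mul hinv ?_ (norm_nonneg _) (by positivity)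
  rw [stepErr]
  refine (norm_sub_le _ _).trans (add_le_add ((norm_add_le _ _).trans (add_le_add hcirc hpiece2)) hpiece3)

include hB hΦ hd hU hU0 hu hS hρ₀ hBρ hη hΦ' in
/-- **First-order expansion of the step** (Lawler's Prop. 4.40 / [LSW] (5.2), quantitative, slid
coordinates): for `|z| ≤ ρ₀/4`,

  `|h'(z) - h(z) - 2u D(z)| ≤ 25000 u (η ρ₀ + u)/(d ρ₀³)`,

by Cauchy's formula over `|ζ| = ρ₀/2` (`h' - h` is holomorphic on the closed disc, `D` is the
Cauchy integral of `d²/E_B - E_B'/ζ`) and the sphere bound `norm_smul_sub_drift_le`.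
[cite: Lawler2005, Prop. 4.40; LawlerSchrammWerner2003Restriction §5 (5.2)] -/
theorem norm_hmapT_sub_hmap_sub_le {z : ℂ} (hz : ‖z‖ ≤ ρ₀ / 4) :
    ‖(hmapT Φ' (U u) z - hmap Φ z) - 2 * (u : ℂ) * driftFun Φ d ρ₀ z‖ ≤
      25000 * u * (stepSize S u * ρ₀ + u) / (d * ρ₀ ^ 3) := by
  obtain ⟨hd0, hd1, hη0, hη1, huη, huρ⟩ := stepSize_small hB hΦ hd hu hS hρ₀ hη
  obtain ⟨ha5, -⟩ := stepCap_le hB hΦ hd hU hU0 hu hS hρ₀ hBρ hη hΦ'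
  obtain ⟨hsub, hE, -⟩ := differentiableOn_hmap hB hΦ hρ₀ hBρ
  have hD := differentiableOn_hmapT_sub_hmap hB hΦ hd hU hU0 hu hS hρ₀ hBρ hη hΦ'
  have hρ2 : 0 < ρ₀ / 2 := by positivity
  have hzb : z ∈ ball (0 : ℂ) (ρ₀ / 2) := mem_ball_zero_iff.2 (by linarith)
  -- Cauchy formula for `h' - h`
  have hdc : DiffContOnCl ℂ (fun w ↦ hmapT Φ' (U u) w - hmap Φ w) (ball (0 : ℂ) (ρ₀ / 2)) := by
    refine DifferentiableOn.diffContOnCl ?_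
    rw [closure_ball 0 hρ2.ne']
    exact hD.mono (closedBall_subset_ball (by linarith))
  have hC := hdc.two_pi_i_inv_smul_circleIntegral_sub_inv_smul hzb
  -- integrability on the sphere
  have hsph4 : sphere (0 : ℂ) (ρ₀ / 2) ⊆ ball (0 : ℂ) (4 * ρ₀) :=
    sphere_subset_closedBall.trans (closedBall_subset_ball (by linarith))
  have hne : ∀ ζ ∈ sphere (0 : ℂ) (ρ₀ / 2), ζ ≠ 0 ∧ hullExt Φ ζ ≠ 0 ∧ ζ - z ≠ 0 := fun ζ hζ ↦ by
    have hζ' : ‖ζ‖ = ρ₀ / 2 := by simpa using hζ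
    have hζ0 : ζ ≠ 0 := by intro h; rw [h, norm_zero] at hζ'; linarith
    refine ⟨hζ0, hullExt_ne_zero hB hΦ hd hρ₀ hBρ (hsph4 hζ) hζ0, ?_⟩
    intro h; rw [sub_eq_zero] at h; rw [h] at hζ'; linarith
  have hinvc : ContinuousOn (fun ζ ↦ (ζ - z)⁻¹) (sphere (0 : ℂ) (ρ₀ / 2)) :=
    (continuousOn_id.sub continuousOn_const).inv₀ fun ζ hζ ↦ (hne ζ hζ).2.2
  have hiΔ : CircleIntegrable (fun ζ ↦ (ζ - z)⁻¹ • (hmapT Φ' (U u) ζ - hmap Φ ζ)) 0 (ρ₀ / 2) :=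
    (hinvc.smul (hD.continuousOn.mono hsph4)).circleIntegrable hρ2.le
  have hE'c : ContinuousOn (deriv (hullExt Φ)) (ball (0 : ℂ) (4 * ρ₀)) :=
    ((hE.analyticOnNhd isOpen_ball).deriv).continuousOn
  have hiF : CircleIntegrable
      (fun ζ ↦ (ζ - z)⁻¹ • ((d : ℂ) ^ 2 / hullExt Φ ζ - deriv (hullExt Φ) ζ / ζ)) 0 (ρ₀ / 2) := by
    refine (hinvc.smul ?_).circleIntegrable hρ2.le
    exact (continuousOn_const.div (hE.continuousOn.mono hsph4) fun ζ hζ ↦ (hne ζ hζ).2.1).sub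
      ((hE'c.mono hsph4).div continuousOn_id fun ζ hζ ↦ (hne ζ hζ).1)
  -- the difference as one Cauchy integral
  have hrepr : (hmapT Φ' (U u) z - hmap Φ z) - 2 * (u : ℂ) * driftFun Φ d ρ₀ z =
      (2 * π * I)⁻¹ • ∮ ζ in C(0, ρ₀ / 2), (ζ - z)⁻¹ • ((hmapT Φ' (U u) ζ - hmap Φ ζ) -
        2 * (u : ℂ) * ((d : ℂ) ^ 2 / hullExt Φ ζ - deriv (hullExt Φ) ζ / ζ)) := by
    rw [driftFun]
    have hfun : (fun ζ ↦ (ζ - z)⁻¹ • ((hmapT Φ' (U u) ζ - hmap Φ ζ) -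
        2 * (u : ℂ) * ((d : ℂ) ^ 2 / hullExt Φ ζ - deriv (hullExt Φ) ζ / ζ))) =
        fun ζ ↦ (ζ - z)⁻¹ • (hmapT Φ' (U u) ζ - hmap Φ ζ) -
          (2 * (u : ℂ)) • ((ζ - z)⁻¹ • ((d : ℂ) ^ 2 / hullExt Φ ζ - deriv (hullExt Φ) ζ / ζ)) := by
      funext ζ; simp only [smul_eq_mul]; ring
    rw [hfun, circleIntegral.integral_sub hiΔ (hiF.const_fun_smul (a := 2 * (u : ℂ))),
      circleIntegral.integral_smul, smul_sub]
    conv_lhs => rw [← hC]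
    simp only [smul_eq_mul]
    ring
  rw [hrepr]
  have hint := circleIntegral.norm_two_pi_i_inv_smul_integral_le_of_norm_le_const hρ2.le
    fun ζ hζ ↦ norm_smul_sub_drift_le hB hΦ hd hU hU0 hu hS hρ₀ hBρ hη hΦ' hz hζ
  refine hint.trans ?_
  rw [show ρ₀ / 2 * (4 / ρ₀ * stepErr (stepCap Φ Φ' (2 * stepSize S u)) u (stepSize S u) d ρ₀) =
    2 * stepErr (stepCap Φ Φ' (2 * stepSize S u)) u (stepSize S u) d ρ₀ by field_simp; ring]
  exact two_stepErr_le hd0 hd1 hρ₀ u.coe_nonneg hη0 ha5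

end Loewner

end Literature.Probability.RandomPlanarGeometry
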